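import Mathlib

/-!
# Venture HSemireg — W3 SPECIAL FIBRES: the LCI FRAME for Schoen's carrier — the mixed Petri maps at the
# Ries members and the route's bookkeeping (seat `w3-jac-1` g10, file of record `widen/W3/W3-JAC-1-RIES.md`
# v2.1, §6.12)

HONEST FRAMING. Lean index of the computation cell `pub-hsemireg`, widening seat `w3-jac-1`.  ELEMENTARY
ALGEBRA AND ARITHMETIC ONLY: no curve, no cover, no symmetric product, no normal bundle and no deformation is
constructed here.  On paper (RIES §6.12 (a)) the first-order deformation space of the lci carrier `X ⊂ M = C̃^{(8)}`
is `T¹(X) = ker(H¹(T_M∣_X) → H¹(N_{X/M}))` because `H⁰(N_{X/M}) = 0`; (§6.12 (b)) on the `36` restricted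
curve classes this map is the off-diagonal period block, injective on the `24` non-invariant classes as soon as
the MIXED PETRI MAPS `μ₀ⱼ : H⁰(K_Y) ⊗ H⁰(K_Y ⊗ ηʲ) → H⁰(K_Y² ⊗ ηʲ)` (`5·4 = 20 → 12`) are onto; (§6.12 (c)) at a
Ries member `Y → ℙ¹` is hyperelliptic, `H⁰(K_Y) = H⁰(𝒪_{ℙ¹}(4))`, `φ_*ηʲ ≅ 𝒪(a) ⊕ 𝒪(b)` with `a + b = −6`, and
`μ₀ⱼ` is the direct sum over the two summands of the multiplication of binary forms
`H⁰(𝒪_{ℙ¹}(4)) ⊗ H⁰(𝒪_{ℙ¹}(c + 4)) → H⁰(𝒪_{ℙ¹}(c + 8))`, which is ONTO whenever `c + 4 ≥ 0` — the algebraic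
heart is `mul_degreeLE`: polynomials of degree `≤ m` times polynomials of degree `≤ n` span the polynomials of
degree `≤ m + n` (the inhomogeneous form of the statement on binary forms).  The splitting types allowed by
`h⁰(K ⊗ η) = 4` are `(−3,−3), (−2,−4), (−1,−5)` (`splitting_types_from_h0`); the `S₃`-closure pins them to a
degree-`(−6)` rank-`2` summand of `U ⊕ U`, `U = 𝒪(−3)²` or `𝒪(−2) ⊕ 𝒪(−4)` the dual Tschirnhausen bundle of
the trigonal genus-`4` curve, hence to `(−3,−3)` or `(−2,−4)` (`summand_of_U_plus_U_33`, `summand_of_U_plus_U_24`),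
both with `a + 4, b + 4 ≥ 0` (`ries_types_surjective`) — so `rank β ≥ 24` and the Ries route reads
`h¹(X̃_t, T) ≤ h − 24` with `h = h¹(X₀, T_{C̃₀^{(8)}}∣_{X₀})`: `h ≤ 39 ⇒ ≤ 15 < 16` (object side NO),
`h = 36 ⇒ = 12` (REMARK SC) (`route_bookkeeping`).  The character bookkeeping of `H¹(C̃₀, T)` as an
`S₃`-module (`triv⁹ ⊕ sgn³ ⊕ std¹²`, `character_bookkeeping`), the corner stratum's `24 = 9 + 15 = 21 − 12 + 15`
(`corner_stratum_count`), the Riemann–Roch and push-forward degrees used (`mixed_petri_dimensions`,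
`pushforward_degree`, `closure_genus_check`) and Maroni's bound at every rung (`maroni_every_rung`) are recorded
as the arithmetic identities they are.  Nothing here says that HC, HC_CM or HC_AV holds, that any object is
semiregular, or that the geometric hypotheses of RIES §6.12 are met; tiers are the W3 pen's.

CONTENT (all PROVED, 0 sorry), namespace `Summit.Ventures.HSemireg.SchoenCarrierMixedPetri`.
-/

namespace Summit.Ventures.HSemireg.SchoenCarrierMixedPetri

open Polynomial

section Multiplication

variable (R : Type*) [CommRing R]

/-- RIES §6.12 (c), algebraic heart: the multiplication map
`H⁰(𝒪_{ℙ¹}(m)) ⊗ H⁰(𝒪_{ℙ¹}(n)) → H⁰(𝒪_{ℙ¹}(m+n))` is onto for `m, n ≥ 0` — in the affine chart,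
polynomials of degree `≤ m` times polynomials of degree `≤ n` span exactly the polynomials of degree
`≤ m + n`. -/
theorem mul_degreeLE (m n : ℕ) :
    Polynomial.degreeLE R (m : WithBot ℕ) * Polynomial.degreeLE R (n : WithBot ℕ) =
      Polynomial.degreeLE R ((m + n : ℕ) : WithBot ℕ) := by
  classical
  apply le_antisymm
  · rw [Submodule.mul_le]
    intro p hp q hq
    rw [Polynomial.mem_degreeLE] at hp hq ⊢
    calc (p * q).degree ≤ p.degree + q.degree := Polynomial.degree_mul_le p q
      _ ≤ (m : WithBot ℕ) + (n : WithBot ℕ) := add_le_add hp hq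
      _ = ((m + n : ℕ) : WithBot ℕ) := by push_cast; rfl
  · rw [Polynomial.degreeLE_eq_span_X_pow (n := m + n), Submodule.span_le]
    intro p hp
    simp only [Finset.coe_image, Finset.coe_range, Set.mem_image, Set.mem_Iio] at hp
    obtain ⟨k, hk, rfl⟩ := hp
    have hsplit : (X : R[X]) ^ k = X ^ (min k m) * X ^ (k - min k m) := by
      rw [← pow_add]; congr 1; omega
    rw [hsplit]
    apply Submodule.mul_mem_mul
    · rw [Polynomial.mem_degreeLE]
      calc ((X : R[X]) ^ (min k m)).degree ≤ ((min k m : ℕ) : WithBot ℕ) := Polynomial.degree_X_pow_le _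
        _ ≤ (m : WithBot ℕ) := by exact_mod_cast (min_le_right k m)
    · rw [Polynomial.mem_degreeLE]
      calc ((X : R[X]) ^ (k - min k m)).degree ≤ ((k - min k m : ℕ) : WithBot ℕ) :=
            Polynomial.degree_X_pow_le _
        _ ≤ (n : WithBot ℕ) := by exact_mod_cast (show k - min k m ≤ n by omega)

/-- RIES §6.12 (c): in particular every polynomial of degree `≤ m + n` lies in the product submodule
(surjectivity in the form it is used: the target `H⁰(𝒪(a+8))` is reached from `H⁰(𝒪(4)) ⊗ H⁰(𝒪(a+4))`
whenever `a + 4 ≥ 0`). -/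
theorem mem_mul_degreeLE_of_degree_le (m n : ℕ) (p : R[X]) (hp : p.degree ≤ ((m + n : ℕ) : WithBot ℕ)) :
    p ∈ Polynomial.degreeLE R (m : WithBot ℕ) * Polynomial.degreeLE R (n : WithBot ℕ) := by
  rw [mul_degreeLE, Polynomial.mem_degreeLE]
  exact hp

end Multiplication

/-- RIES §6.12 (c): with `h⁰(𝒪_{ℙ¹}(k)) = max(k+1, 0)`, a splitting type `φ_*η ≅ 𝒪(a) ⊕ 𝒪(b)`,
`a + b = −6`, `b ≤ a`, with `h⁰(K ⊗ η) = h⁰(𝒪(a+4)) + h⁰(𝒪(b+4)) = 4` is one of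
`(−3,−3), (−2,−4), (−1,−5)`. -/
theorem splitting_types_from_h0 (a b : ℤ) (hsum : a + b = -6) (hord : b ≤ a)
    (h0 : Int.toNat (a + 5) + Int.toNat (b + 5) = 4) :
    (a = -3 ∧ b = -3) ∨ (a = -2 ∧ b = -4) ∨ (a = -1 ∧ b = -5) := by
  omega

/-- RIES §6.12 (c): for each of the three types `h⁰(K² ⊗ η) = h⁰(𝒪(a+8)) + h⁰(𝒪(b+8)) = 12` as it must
(Riemann–Roch), and the cokernel of `μ₀ⱼ`, `Σ_{c : c+4<0} h⁰(𝒪(c+8))`, is `0, 0, 4` respectively. -/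
theorem cokernel_by_type :
    (Int.toNat (-3 + 9) + Int.toNat (-3 + 9) = 12 ∧ Int.toNat (-2 + 9) + Int.toNat (-4 + 9) = 12 ∧
      Int.toNat (-1 + 9) + Int.toNat (-5 + 9) = 12) ∧
    (0 ≤ (-3 : ℤ) + 4 ∧ 0 ≤ (-2 : ℤ) + 4 ∧ 0 ≤ (-4 : ℤ) + 4 ∧ ¬ 0 ≤ (-5 : ℤ) + 4 ∧
      Int.toNat (-5 + 9) = 4) := by
  refine ⟨⟨by decide, by decide, by decide⟩, by decide, by decide, by decide, by decide, by decide⟩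

/-- RIES §6.12 (c), Krull–Schmidt step, general trigonal genus-4 curve (`U = 𝒪(−3)²`): a rank-2 summand
of `U ⊕ U = 𝒪(−3)⁴` has both degrees equal to `−3`. -/
theorem summand_of_U_plus_U_33 (a b : ℤ) (ha : a ∈ ({-3} : Set ℤ)) (hb : b ∈ ({-3} : Set ℤ)) :
    a = -3 ∧ b = -3 ∧ a + b = -6 ∧ 0 ≤ a + 4 ∧ 0 ≤ b + 4 := by
  simp only [Set.mem_singleton_iff] at ha hb
  subst ha; subst hb
  refine ⟨rfl, rfl, by norm_num, by norm_num, by norm_num⟩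

/-- RIES §6.12 (c), Krull–Schmidt step, quadric-cone case (`U = 𝒪(−2) ⊕ 𝒪(−4)`): a rank-2 summand of
`U ⊕ U = 𝒪(−2)² ⊕ 𝒪(−4)²` of degree `−6` with `b ≤ a` is `𝒪(−2) ⊕ 𝒪(−4)`. -/
theorem summand_of_U_plus_U_24 (a b : ℤ) (_ha : a = -2 ∨ a = -4) (hb : b = -2 ∨ b = -4)
    (hsum : a + b = -6) (hord : b ≤ a) : a = -2 ∧ b = -4 ∧ 0 ≤ a + 4 ∧ 0 ≤ b + 4 := by
  omega

/-- RIES §6.12 (c): at every Ries member the splitting type is `(−3,−3)` or `(−2,−4)`, and in both cases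
`a + 4 ≥ 0`, `b + 4 ≥ 0` — so both summands of `μ₀ⱼ` are onto (by `mul_degreeLE` with
`(m, n) = (4, a+4), (4, b+4)`), `h⁰(K ⊗ η) = 4` and `h⁰(K² ⊗ η) = 12`. -/
theorem ries_types_surjective (a b : ℤ) (h : (a = -3 ∧ b = -3) ∨ (a = -2 ∧ b = -4)) :
    0 ≤ a + 4 ∧ 0 ≤ b + 4 ∧ Int.toNat (a + 5) + Int.toNat (b + 5) = 4 ∧
      Int.toNat (a + 9) + Int.toNat (b + 9) = 12 := by
  omega

/-- RIES §6.12 (b)–(c), dimensions: `g(Y) = 5`, `deg K_Y = 8`, `η` non-trivial of degree `0`: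
`h⁰(K ⊗ η) = 8 + 1 − 5 = 4` (non-special), `h⁰(K² ⊗ η) = 16 + 1 − 5 = 12`, `h⁰(K) = 5`, the source of
`μ₀ⱼ` has dimension `5 · 4 = 20 ≥ 12`; the non-invariant curve classes number
`(3·13 − 3) − (3·5 − 3) = 24 = 2 · 12`, matching the two perfect pairings `H¹(T)ⱼ × H⁰(K²)₋ⱼ → ℂ`. -/
theorem mixed_petri_dimensions :
    (8 : ℤ) + 1 - 5 = 4 ∧ (16 : ℤ) + 1 - 5 = 12 ∧ 5 * 4 = (20 : ℕ) ∧ 12 ≤ (20 : ℕ) ∧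
      (3 * 13 - 3) - (3 * 5 - 3) = (24 : ℕ) ∧ 24 = 2 * (12 : ℕ) := by
  refine ⟨by norm_num, by norm_num, by norm_num, by norm_num, by norm_num, by norm_num⟩

/-- RIES §6.12 (c): Riemann–Roch for the double cover `φ : Y → ℙ¹` (`g(Y) = 5`): for `L ∈ Pic⁰(Y)`,
`χ(L) = 0 + 1 − 5 = deg(φ_*L) + 2` forces `deg φ_*L = −6 = −(g + 1)`; and for the triple cover
`τ : C' → ℙ¹` (`g(C') = 4`), `χ(𝒪_{C'}) = 1 − 4 = deg(τ_*𝒪) + 3` forces `deg τ_*𝒪 = −6 = −(g + 2)`,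
`χ(ℳ⁻¹) = −6 + 1 − 4 = deg(τ_*ℳ⁻¹) + 3` forces `deg τ_*ℳ⁻¹ = −12`. -/
theorem pushforward_degree (dE dU dM : ℤ) (h1 : (0 : ℤ) + 1 - 5 = dE + 2)
    (h2 : (1 : ℤ) - 4 = dU + 3) (h3 : (-6 : ℤ) + 1 - 4 = dM + 3) :
    dE = -6 ∧ dU = -6 ∧ dM = -12 := by
  omega

/-- RIES §6.12 (c), consistency of the `S₃`-closure decomposition `φ̃_*𝒪_{C̃} ≅ 𝒪 ⊕ 𝒪(−6) ⊕ U ⊕ U`: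
`h¹(𝒪(−6)) + 2·h¹(U) = 5 + 2·4 = 13 = g(C̃)` for `U = 𝒪(−3)²` (`h¹(𝒪(−3)) = 2`) and for
`U = 𝒪(−2) ⊕ 𝒪(−4)` (`h¹ = 1 + 3`); degrees: `0 − 6 − 6 − 6 = −18 = deg τ_*𝒪 + deg τ_*ℳ⁻¹`; and
`U^∨(−6) ≅ U`: `(3 − 6, 3 − 6) = (−3, −3)`, `(2 − 6, 4 − 6) = (−4, −2)`. -/
theorem closure_genus_check :
    5 + 2 * (2 + 2) = (13 : ℕ) ∧ 5 + 2 * (1 + 3) = (13 : ℕ) ∧ (0 : ℤ) - 6 - 6 - 6 = -6 + (-12) ∧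
      ((3 : ℤ) - 6 = -3) ∧ ((2 : ℤ) - 6 = -4 ∧ (4 : ℤ) - 6 = -2) := by
  refine ⟨by norm_num, by norm_num, by norm_num, by norm_num, by norm_num, by norm_num⟩

/-- RIES §6.12 (f)(1): `H¹(C̃₀, T)` (`36 = 3·13 − 3`) as an `S₃`-module `triv^a ⊕ sgn^b ⊕ std^c`:
`a + b + 2c = 36`, the `σ`-invariants `a + b = 12 = 3·5 − 3` (`= H¹(Y, T_Y)`), the `ι̃`-invariants
`a + c = 21` (`= h¹(C', T_{C'}(−B))`, `12` branch points: `18 + 3`) force `(a, b, c) = (9, 3, 12)` — nine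
trigonal moduli, three normal directions of the hyperelliptic locus (`12 − 9`), and the anti-invariants
`b + c = 15 = h¹(C', T_{C'} ⊗ ℳ⁻¹)` (`12 + 3`). -/
theorem character_bookkeeping (a b c : ℤ) (h36 : a + b + 2 * c = 3 * 13 - 3) (hσ : a + b = 3 * 5 - 3)
    (hι : a + c = 18 + 3) : a = 9 ∧ b = 3 ∧ c = 12 ∧ b = 12 - 9 ∧ b + c = 12 + 3 := by
  omega

/-- RIES §6.12 (f)(1): the corner stratum `C'^{(4)}` sees `H¹(T_{C'}) ⊕ H¹(T_{C'} ⊗ ℳ⁻¹) = 9 + 15 = 24`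
of the `36` curve classes: the `ι̃₀`-invariant `21` through «forget the `12` branch points» (`21 − 12 = 9`)
and the anti-invariant `15` identically; per axis `24`, over the five strata with `1+3+2+2+2 = 10` axis
slots `240`; Riemann–Roch on the genus-4 curve: `h¹(T) = 6 + 3`, `h¹(T ⊗ ℳ⁻¹) = 12 + 3`,
`h¹(ℳ⁻¹) = 6 + 3`, `h¹(T(−B)) = 18 + 3`. -/
theorem corner_stratum_count :
    (6 + 3) + (12 + 3) = (24 : ℕ) ∧ (18 + 3) - 12 + (12 + 3) = (24 : ℕ) ∧ 6 + 3 = (9 : ℕ) ∧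
      24 * (1 + 3 + 2 + 2 + 2) = (240 : ℕ) ∧ (18 + 3) + (12 + 3) = 3 * 13 - (3 : ℕ) := by
  refine ⟨by norm_num, by norm_num, by norm_num, by norm_num, by norm_num⟩

/-- RIES §6.12 (c), EVERY RUNG: for a trigonal curve of genus `d ≥ 2` with Tschirnhausen degrees
`e₁ + e₂ = d + 2`, `e₁ ≤ e₂`, Maroni's bound `e₂ − e₁ ≤ (d + 2)/3` gives `e₂ ≤ d`, i.e. `−e₂ + d ≥ 0`:
the mixed Petri map `H⁰(𝒪(d)) ⊗ H⁰(𝒪(d − eᵢ)) → H⁰(𝒪(2d − eᵢ))` is onto on both summands; and the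
certified rank is `6r − 6 = 6d` (`12, 18, 24, 30` at `d = 2, 3, 4, 5`). -/
theorem maroni_every_rung (d e₁ e₂ : ℕ) (hd : 2 ≤ d) (hsum : e₁ + e₂ = d + 2) (hle : e₁ ≤ e₂)
    (hmar : e₂ - e₁ ≤ (d + 2) / 3) : e₂ ≤ d ∧ e₁ ≤ d ∧ 6 * (d + 1) - 6 = 6 * d := by
  omega

/-- RIES §6.12 (d), the route's bookkeeping: with `rank β ≥ 24`, `h¹(X̃_t, T) ≤ h − 24`; the
door-sufficient bound `≤ 15 < 16` is `h ≤ 39`, REMARK SC's `12` is `h = 36` (and `h ≥ 36` always, the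
`36` curve classes restricting injectively); `h ∈ {37, 38, 39}` leaves at most `3` exotic classes. -/
theorem route_bookkeeping (h t : ℕ) (hβ : t + 24 ≤ h) :
    (h ≤ 39 → t ≤ 15 ∧ t < 16) ∧ (h = 36 → t ≤ 12) ∧ (h ≤ 39 → 36 ≤ h → h - 36 ≤ 3) := by
  omega

end Summit.Ventures.HSemireg.SchoenCarrierMixedPetri
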